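import Literature.NumberTheory.NumberFields.RayClassFieldLocalTowerDisjoint
import Literature.NumberTheory.NumberFields.RayClassFieldSplitPrimePowerDegree
import HarnessLib

/-!
# The LAYER-APPROXIMATION of the two-variable local tower by Artin lifts: `σl_a ≡ τ` on `E_N·K_π^{N+1}` as soon as
# `(𝔞_a, K(𝔤v'^{N+1}v^{N+1})/K) = res τ |_{K(𝔤v'^{N+1}v^{N+1})}` — input (G) of the local (c)-identity reduced to Artin symbols on finite layers
# (de Shalit II.1.10: the global tower generates the local one; II.4.14)

Setting of `RayClassFieldLocalTowerDisjoint` / `…Containment` (number field `K` totally complex, place `v`, uniformiser `π` of `K_v`, moduli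
`𝔤v'^{i+1}` with `α_i = π^{f_i} ≡ 1 mod 𝔤v'^{i+1}`, a local unramified tower `E_j` with the global level `i` at the local level `i + c`:
`f_i ∣ deg w` on `Γ_{E_{i+c}}` and INERT: `E_{i+c} ⊆ K_v·ι(K(𝔤v'^{i+1}))`).  The hypothesis `happrox` of the (c)-capstone
(`Summit…ColemanCoinvariantArtin.charIdeal_coinvariants_colemanImage_closure_eq_span_of_mul_rule`, and `…ColemanCoinvariantEllipticUnits`) asks
that a family `σl_a ∈ Γ_{K_v}` approximate EVERY `τ ∈ Γ_{K_v}` on EVERY layer `E_N·K_π^{N+1}`.  THIS file reduces it to finite GLOBAL layers: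

* ★ `smul_eq_smul_on_sup_ltField_of_agree_on_rayClassField` — if `σl` and `τ` agree on `ι(K(𝔤v'^{N+1}v^{N+1}))`, they agree on `E_N·K_π^{N+1}`
  (`σl⁻¹τ` fixes `ι(K(𝔤v'^{N+1}))`, hence `E_{N+c}` by inertness, hence `K_π^{N+1}` by the linear disjointness
  `mem_fixingSubgroup_ltField_of_forall_smul_absClosureEmbedding_eq`, and `E_N ≤ E_{N+c}`);
* ★★ `happrox_of_artin_layers` — **`happrox` from**: for every `N` and `τ ∈ Γ_{K_v}` some index `a` has `res σl_a ≡ res τ` on the diagonal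
  layer `K(𝔤v'^{N+1}v^{N+1})` — with `hσ` (`res σl_a|_{K(·)} = (𝔞_a, ·)`) this is the statement that every element of the local image
  (decomposition group) at each finite layer is the Artin symbol of an admissible ideal: Artin surjectivity + finiteness of the set of primes
  above `v` in `K(𝔤v'^∞v^∞)` (the remaining arithmetic input, not proved here);
* `happrox_of_artinSymbol_layers` — the same with the layer condition written with `absRestrictNormalHom`.

Theorems only; no `sorry`; no definitions.

## References
* [deShalit1987] E. de Shalit, *Iwasawa theory of elliptic curves with complex multiplication* (1987), II.1.10 Lemma and Corollary (p. 39),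
  II.4.12 (p. 66), II.4.14 (p. 71).
* [NeukirchANT1999] J. Neukirch, *Algebraic Number Theory* (1999), Ch. VI §5 Prop. (5.6), §7 Thm. (7.1).
-/

noncomputable section

open NumberField IsDedekindDomain IsDedekindDomain.HeightOneSpectrum Field
open scoped nonZeroDivisors Classical

namespace Literature.NumberTheory.NumberFields

open Literature.NumberTheory.GaloisRepresentations
open Literature.NumberTheory.GaloisRepresentations.IsNonarchimedeanLocalField
open ValuativeRel

variable {K : Type} [Field K] [NumberField K] {𝔤 : Ideal (𝓞 K)} {v v' : HeightOneSpectrum (𝓞 K)}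

omit [NumberField K] in
/-- `((τ|_L) x : K̄) = τ • x`. [folklore] -/
private theorem coe_absRestrictNormalHom_apply₁₄ (L : IntermediateField K (AlgebraicClosure K)) [Normal K L]
    (τ : absoluteGaloisGroup K) (x : L) :
    ((absRestrictNormalHom L τ x : L) : AlgebraicClosure K) = τ • (x : AlgebraicClosure K) :=
  AlgEquiv.restrictNormalHom_apply L _ x

variable [IsTotallyComplex K]
  (h𝔤0 : 𝔤 ≠ ⊥) (hv : ¬ 𝔤 ≤ v.asIdeal) (hvv' : v' ≠ v) (hw : ∀ u : (𝓞 K)ˣ, (u : 𝓞 K) - 1 ∈ 𝔤 * v'.asIdeal → u = 1)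
  {π : 𝒪[v.adicCompletion K]} (hπ : (valuation (v.adicCompletion K)).IsUniformizer (π : v.adicCompletion K))
  {α : ℕ → 𝓞 K} (hα0 : ∀ i, α i ≠ 0) (hα𝔪 : ∀ i, α i - 1 ∈ 𝔤 * v'.asIdeal ^ (i + 1))
  (hαw : ∀ i, ∀ w : HeightOneSpectrum (𝓞 K), w ≠ v → α i ∉ w.asIdeal)
  {f : ℕ → ℕ} (hαπ : ∀ i, ((α i : K) : v.adicCompletion K) = (π : v.adicCompletion K) ^ f i)
  (E : ℕ → IntermediateField (v.adicCompletion K) (AlgebraicClosure (v.adicCompletion K)))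
  [∀ j, FiniteDimensional (v.adicCompletion K) (E j)] (hmono : Monotone E) (c : ℕ)
  (hdegE : ∀ i, ∀ w : WeilGroup (v.adicCompletion K),
    WeilGroup.toAbsGalois (v.adicCompletion K) w ∈ (E (i + c)).fixingSubgroup → (f i : ℤ) ∣ WeilGroup.deg w)
  (hinert : ∀ i, ∀ τ : absoluteGaloisGroup (v.adicCompletion K),
    (∀ y ∈ rayClassField K (𝔤 * v'.asIdeal ^ (i + 1)),
      τ • absClosureEmbedding K (v.adicCompletion K) y = absClosureEmbedding K (v.adicCompletion K) y) →
      τ ∈ (E (i + c)).fixingSubgroup)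

omit [IsTotallyComplex K] in
/-- `v ∤ 𝔤v'^{i+1}`. [cite: deShalit1987, II.4.14 (p. 71)] -/
private theorem not_moduli_le₁₄ (hv : ¬ 𝔤 ≤ v.asIdeal) (hvv' : v' ≠ v) (i : ℕ) : ¬ 𝔤 * v'.asIdeal ^ (i + 1) ≤ v.asIdeal := by
  intro h
  rcases (v.isPrime.mul_le).mp h with h1 | h2
  · exact hv h1
  · exact hvv' (HeightOneSpectrum.ext ((v'.isMaximal.eq_of_le v.isPrime.ne_top ((Ideal.IsPrime.pow_le_iff (hP := v.isPrime)
      (Nat.succ_ne_zero i)).mp h2))))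

include h𝔤0 hv hvv' hw hπ hα0 hα𝔪 hαw hαπ hmono hdegE hinert in
/-- ★ **Agreement on the global layer forces agreement on the local layer**: if `σl, τ ∈ Γ_{K_v}` act alike on `ι(K(𝔤v'^{N+1}v^{N+1}))`, they
act alike on `E_N·K_π^{N+1}` (`σl⁻¹τ` fixes `ι(K(𝔤v'^{N+1}))` ⟹ fixes `E_{N+c}` (inert) ⟹ fixes `K_π^{N+1}` (linear disjointness) ⟹ fixes
`E_N·K_π^{N+1} ≤ E_{N+c}·K_π^{N+1}`). [cite: deShalit1987, II.1.10 Lemma and Corollary (p. 39), II.4.14 (p. 71)] -/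
theorem smul_eq_smul_on_sup_ltField_of_agree_on_rayClassField (N : ℕ) {σ τ : absoluteGaloisGroup (v.adicCompletion K)}
    (h : ∀ y ∈ rayClassField K (𝔤 * v'.asIdeal ^ (N + 1) * v.asIdeal ^ (N + 1)),
      σ • absClosureEmbedding K (v.adicCompletion K) y = τ • absClosureEmbedding K (v.adicCompletion K) y)
    (z : (E N ⊔ ltField π N : IntermediateField (v.adicCompletion K) (AlgebraicClosure (v.adicCompletion K)))) :
    σ • (z : AlgebraicClosure (v.adicCompletion K)) = τ • (z : AlgebraicClosure (v.adicCompletion K)) := by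
  -- `σ⁻¹τ` fixes `ι(K(𝔤v'^{N+1}v^{N+1}))` pointwise
  have hfix : ∀ y ∈ rayClassField K (𝔤 * v'.asIdeal ^ (N + 1) * v.asIdeal ^ (N + 1)),
      (σ⁻¹ * τ) • absClosureEmbedding K (v.adicCompletion K) y = absClosureEmbedding K (v.adicCompletion K) y := by
    intro y hy
    rw [mul_smul, ← h y hy, inv_smul_smul]
  -- hence `E_{N+c}` (inert step: `K(𝔤v'^{N+1}) ≤ K(𝔤v'^{N+1}v^{N+1})`)
  have hle : rayClassField K (𝔤 * v'.asIdeal ^ (N + 1)) ≤ rayClassField K (𝔤 * v'.asIdeal ^ (N + 1) * v.asIdeal ^ (N + 1)) :=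
    rayClassField_le_of_le (mul_ne_zero (mul_ne_zero h𝔤0 (pow_ne_zero _ v'.ne_bot)) (pow_ne_zero _ v.ne_bot)) Ideal.mul_le_right
  have hE : σ⁻¹ * τ ∈ (E (N + c)).fixingSubgroup := hinert N _ fun y hy ↦ hfix y (hle hy)
  -- hence `E_{N+c} ⊔ K_π^{N+1}`
  have hsup := mem_fixingSubgroup_sup_ltField_of_forall_smul_absClosureEmbedding_eq (mul_ne_zero h𝔤0 (pow_ne_zero _ v'.ne_bot))
    (not_moduli_le₁₄ hv hvv' N) (fun u hu ↦ hw u (Ideal.mul_mono_right (by rw [pow_succ]; exact Ideal.mul_le_left) hu)) hπ (hα0 N) (hα𝔪 N)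
    (hαw N) (hαπ N) (E (N + c)) (hdegE N) N hE hfix
  -- and `E_N ⊔ K_π^{N+1} ≤ E_{N+c} ⊔ K_π^{N+1}`
  have hz : (z : AlgebraicClosure (v.adicCompletion K)) ∈
      (E (N + c) ⊔ ltField π N : IntermediateField (v.adicCompletion K) (AlgebraicClosure (v.adicCompletion K))) :=
    (sup_le_sup_right (hmono (Nat.le_add_right N c)) (ltField π N)) z.2
  have e := (IntermediateField.mem_fixingSubgroup_iff _ _).mp hsup _ hz
  change (σ⁻¹ * τ) • (z : AlgebraicClosure (v.adicCompletion K)) = z at e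
  rw [mul_smul, inv_smul_eq_iff] at e
  exact e.symm

include h𝔤0 hv hvv' hw hπ hα0 hα𝔪 hαw hαπ hmono hdegE hinert in
/-- ★★ **`happrox` FROM THE ARTIN LAYERS**: if for every `N` and every `τ ∈ Γ_{K_v}` some index `a` has `res σl_a ≡ res τ` on the diagonal global
layer `K(𝔤v'^{N+1}v^{N+1})`, then the `σl_a` approximate every `τ` on every local layer `E_N·K_π^{N+1}` — the hypothesis `happrox` of the
(c)-capstone for the elliptic units. [cite: deShalit1987, II.1.10 (p. 39), II.4.14 (p. 71)] [cite: NeukirchANT1999, Ch. VI §7 Thm. (7.1)] -/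
theorem happrox_of_artin_layers {I : Type*} (σl : I → absoluteGaloisGroup (v.adicCompletion K))
    (hlayer : ∀ (N : ℕ) (τ : absoluteGaloisGroup (v.adicCompletion K)), ∃ a : I,
      ∀ y ∈ rayClassField K (𝔤 * v'.asIdeal ^ (N + 1) * v.asIdeal ^ (N + 1)),
        absGaloisRestrict K (v.adicCompletion K) (σl a) • y = absGaloisRestrict K (v.adicCompletion K) τ • y)
    (τ : absoluteGaloisGroup (v.adicCompletion K)) (N : ℕ) :
    ∃ a : I, ∀ z : (E N ⊔ ltField π N : IntermediateField (v.adicCompletion K) (AlgebraicClosure (v.adicCompletion K))),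
      σl a • (z : AlgebraicClosure (v.adicCompletion K)) = τ • (z : AlgebraicClosure (v.adicCompletion K)) := by
  obtain ⟨a, ha⟩ := hlayer N τ
  refine ⟨a, fun z ↦ smul_eq_smul_on_sup_ltField_of_agree_on_rayClassField h𝔤0 hv hvv' hw hπ hα0 hα𝔪 hαw hαπ E hmono c hdegE hinert N
    (fun y hy ↦ ?_) z⟩
  rw [← absGaloisRestrict_apply_smul, ← absGaloisRestrict_apply_smul, ha y hy]

include h𝔤0 hv hvv' hw hπ hα0 hα𝔪 hαw hαπ hmono hdegE hinert in
/-- **`happrox` from the Artin layers, `absRestrictNormalHom` form**: `res σl_a|_{L_N} = res τ|_{L_N}` on the diagonal layers suffices (with `hσ`: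
`(𝔞_a, L_N/K) = res τ|_{L_N}` — every element of the local image at each finite layer is the Artin symbol of an admissible ideal).
[cite: deShalit1987, II.4.12 (p. 66), II.4.14 (p. 71)] [cite: NeukirchANT1999, Ch. VI §5 Prop. (5.6)] -/
theorem happrox_of_artinSymbol_layers {I : Type*} (σl : I → absoluteGaloisGroup (v.adicCompletion K))
    (hlayer : ∀ (N : ℕ) (τ : absoluteGaloisGroup (v.adicCompletion K)), ∃ a : I,
      absRestrictNormalHom (rayClassField K (𝔤 * v'.asIdeal ^ (N + 1) * v.asIdeal ^ (N + 1))) (absGaloisRestrict K (v.adicCompletion K) (σl a)) =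
        absRestrictNormalHom (rayClassField K (𝔤 * v'.asIdeal ^ (N + 1) * v.asIdeal ^ (N + 1))) (absGaloisRestrict K (v.adicCompletion K) τ))
    (τ : absoluteGaloisGroup (v.adicCompletion K)) (N : ℕ) :
    ∃ a : I, ∀ z : (E N ⊔ ltField π N : IntermediateField (v.adicCompletion K) (AlgebraicClosure (v.adicCompletion K))),
      σl a • (z : AlgebraicClosure (v.adicCompletion K)) = τ • (z : AlgebraicClosure (v.adicCompletion K)) := by
  refine happrox_of_artin_layers h𝔤0 hv hvv' hw hπ hα0 hα𝔪 hαw hαπ E hmono c hdegE hinert σl (fun N' τ' ↦ ?_) τ N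
  obtain ⟨a, ha⟩ := hlayer N' τ'
  refine ⟨a, fun y hy ↦ ?_⟩
  have e := congrArg (fun ρ : (rayClassField K (𝔤 * v'.asIdeal ^ (N' + 1) * v.asIdeal ^ (N' + 1))) ≃ₐ[K]
      (rayClassField K (𝔤 * v'.asIdeal ^ (N' + 1) * v.asIdeal ^ (N' + 1))) ↦
      ((ρ ⟨y, hy⟩ : rayClassField K (𝔤 * v'.asIdeal ^ (N' + 1) * v.asIdeal ^ (N' + 1))) : AlgebraicClosure K)) ha
  simpa only [coe_absRestrictNormalHom_apply₁₄] using e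

end Literature.NumberTheory.NumberFields

end
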